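import Mathlib
import HarnessLib
import Literature.Geometry.DiscreteGeometry.TammesThirteen
import Summits.AtomisticToContinuum.Crystallization.Theorems.PricedLinkCensusSoftFourRingsRigMain

/-!
# The twelve-point soft link theorem modulo Tammes-13 (crux `SoftLayerPropagation`, line `Sketch`, stub `stub_softLink`)

Route `PricedLinkCensus`, crux `SoftLayerPropagation` (stmt-AtomisticToContinuum-14233), line `Sketch`.
The registered stub `stub_softLink` of the line is VERBATIM the twelve-point hypothesis `H` of
`Theorems.softFourRings_of_twelve_unit` (item `SoftFourRings`, stmt-AtomisticToContinuum-14234).  Item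
14234's provers proved `SoftFourRings` from the named Literature fact
`musinTarasov2012_tammes_thirteen` (Musin–Tarasov, the Tammes problem for `N = 13`) through exactly this
twelve-point statement (`softFourRings_of_endgameRigidity`, `labelledRigidity_holds`); here we record the
twelve-point statement itself, CONDITIONAL on the same named fact: `stub_softLink_of_tammes13`.  When
`musinTarasov2012_tammes_thirteen` is discharged, `stub_softLink` follows by one application.
-/

noncomputable section

namespace Summit.AtomisticToContinuum.Crystallization.Theorems

open Real RealInnerProductSpace Literature.Geometry.DiscreteGeometry

/-- **The registered stub `stub_softLink` modulo Tammes-13.**  Twelve points `z j` with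
`1 ≤ ‖z j‖ ≤ (1+η) min 1 (n j)`, `n j ≤ ‖z j‖`, `n j ≤ dist (z j) (z k)` (`j ≠ k`) and a `4`-regular soft
link (`η ≤ 1/100`) are `1/4`-matched by a rotated FCC or HCP kissing pattern — assuming the named fact
`musinTarasov2012_tammes_thirteen`.  Proof: the chain of item 14234 (`hull_setting_of_twelve`,
`zero_mem_interior_convexHull_of_twelve_le_card`, `hull_counts_of_twelve`, `no_slack_one_percent`,
`endgameRigidity_of_labelledRigidity` with `Rig.labelledRigidity_holds`), read off before its final
packaging into `SoftFourRings`. -/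
theorem stub_softLink_of_tammes13 : musinTarasov2012_tammes_thirteen →
    ∀ η : ℝ, 0 < η → η ≤ 1 / 100 →
      ∀ (z : Fin 12 → EuclideanSpace ℝ (Fin 3)) (n : Fin 12 → ℝ),
        (∀ j, 1 ≤ ‖z j‖) →
        (∀ j, ‖z j‖ ≤ (1 + η) * min 1 (n j)) →
        (∀ j, n j ≤ ‖z j‖) →
        (∀ j k, j ≠ k → n j ≤ dist (z j) (z k)) →
        (∀ j, (Finset.univ.filter (fun k : Fin 12 =>
            k ≠ j ∧ dist (z j) (z k) ≤ (1 + η) * min (n j) (n k))).card = 4) →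
        ∃ (A : EuclideanSpace ℝ (Fin 3) →ₗᵢ[ℝ] EuclideanSpace ℝ (Fin 3))
          (P : Finset (EuclideanSpace ℝ (Fin 3))),
          (P = Literature.Geometry.DiscreteGeometry.fccKissingPattern ∨
            P = Literature.Geometry.DiscreteGeometry.hcpKissingPattern) ∧
            ∀ p ∈ P, ∃ j : Fin 12, dist (z j) (A p) ≤ 1 / 4 := by
  intro hT η hη hη1 z n h1 h2 h3 h4 h5
  have hER : EndgameRigidity (6 / 25) :=
    endgameRigidity_of_labelledRigidity hT Rig.labelledRigidity_holds
  obtain ⟨X, B, hX1, hcard, hsepX, hB, hBcard, hdeg, hnonbond, hclose⟩ :=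
    hull_setting_of_twelve hη hη1 h1 h2 h3 h4 h5
  have h0 : (0 : EuclideanSpace ℝ (Fin 3)) ∈
      interior (convexHull ℝ (X : Set (EuclideanSpace ℝ (Fin 3)))) :=
    zero_mem_interior_convexHull_of_twelve_le_card hT hX1 hcard.ge
      (ca := 1 - 1 / (2 * (101 / 100 : ℝ) ^ 2)) (by norm_num) hsepX
  obtain ⟨-, -, -, -, -, h34, -, -⟩ := hull_counts_of_twelve hT hX1 hcard hsepX hB hBcard
  obtain ⟨hT8, ht2⟩ := no_slack_one_percent hT hX1 hcard hsepX hB hBcard hdeg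
  obtain ⟨A, P, hP, hAP⟩ := hER X B hX1 hcard hsepX hB hBcard hdeg hnonbond h0 h34 hT8 ht2
  refine ⟨A, P, hP, fun p hp => ?_⟩
  obtain ⟨x, hx, hd⟩ := hAP p hp
  obtain ⟨j, hj⟩ := hclose x hx
  exact ⟨j, by linarith [dist_triangle (z j) x (A p)]⟩

end Summit.AtomisticToContinuum.Crystallization.Theorems

end
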